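import Literature.NumberTheory.EllipticCurves.StrictSelmerRankOne
import HarnessLib

/-!
# Crux `PlecticRankUB` (stmt-BirchSwinnertonDyer-17519), line `Sketch` — stub S3
# `stub_strictSelmerInfinite`: rank `≥ 2` makes the `p`-strict Selmer group infinite

Registered stub S3 of the skeleton of line `Sketch` (route `PlecticLegs`, crux #3,
`Summit.BirchSwinnertonDyer.BirchSwinnertonDyer.Theses.PlecticLegs.PlecticRankUB`): a DESIGN
lemma (a no-go result; it does not feed the composition of the line). For an elliptic curve `E/ℚ`
(any model `W`) with `rank_ℤ E(ℚ) ≥ 2` and any prime `p`, the `p`-strict Selmer group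
`Sel_{p^∞}(E/ℚ) ∩ ker (H¹(ℚ, E[p^∞]) → H¹(ℚ_p, E(ℚ̄_p)[p^∞]))`
(`W.selmerGroupPInfty p ⊓ selmerLocalKerPrimaryTorsion W ℚ_[p] p`) is infinite — the converse
companion of the tree theorem `finite_strictSelmer_of_mordellWeilRank_eq_one`
(`Literature/NumberTheory/EllipticCurves/StrictSelmerRankOne.lean`), whose local computation (§3
there) is run backwards here.

## The argument (Greenberg 1999, §2, pp. 62–63; Silverman AEC VII.6.3, VIII.§1–2)

* Local triviality (`kummerMapLevel_mem_selmerLocalKerPrimaryTorsion_of_eq_nsmul`, any field `K`,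
  any `K`-field `E`): if `X ∈ E(K)` becomes `p^N R` in `E(E)`, the level-`N` Kummer class
  `κ_N(X) = [σ ↦ σQ - Q]` (`p^N Q = X`) restricts to zero in `H¹(E, E(Ē)[p^∞])`: the restricted
  cocycle is the coboundary of `v = ιQ - R ∈ E(Ē)[p^N]` (`R` is `Γ_E`-fixed).
* Kummer classes are Selmer (`ker (H¹(K, E[p^∞]) → H¹(K, E)) ⊆ Sel_{p^∞}`, tree).
* Supply of unbounded level (`exists_kummerMapLevel_mem_strictSelmer`): with a finite-index
  `A ≅ ℤ_p` in `E(E)` (index `m`) and `λ(X) = e(mX) ∈ ℤ_p`, for two points `P₁, P₂ ∈ E(K)` and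
  every `N` there are integers `s, t`, not both divisible by `p`, with `s λ(P₂) + t λ(P₁) ∈ p^N ℤ_p`
  (`ℤ_p` is a valuation ring and `ℤ` is dense in it, `PadicInt.appr_spec`); then
  `m(s P₂ + t P₁) = p^N R` in `E(E)` and `κ_N(m(s P₂ + t P₁))` is a strict Selmer class.
* Infinitude (`infinite_strictSelmer_of_two_le_mordellWeilRank_of_addEquiv`): take `P₁, P₂` in a
  Mordell–Weil basis (rank `≥ 2`). Were the strict Selmer group finite of order `n`, then
  `κ_N(n m (s P₂ + t P₁)) = 0`, so `p^{m'} n m (s P₂ + t P₁) = p^{N+m'} P₀`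
  (`exists_of_kummerMapLevel_eq_zero`); reading the two basis coordinates in `E(K)/tors` gives
  `p^N ∣ n m s` and `p^N ∣ n m t`, hence `p^N ∣ n m` for every `N` — absurd.
* Over `ℚ`, `E = ℚ_p`: `A ≅ ℤ_p` of finite index is Silverman AEC VII.6.3
  (`exists_finiteIndex_addEquiv_padicInt_holds`).

Only theorems; inputs all PROVED in the tree (`zsmul_geomPoints_surjective_holds`,
`exists_isMordellWeilBasis_holds`, `exists_finiteIndex_addEquiv_padicInt_holds`, the `p^∞` Kummer
theory of `SelmerCorankProofs`). No named fact is introduced.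

## References

* [Greenberg1999LNM] R. Greenberg, *Iwasawa theory for elliptic curves*, LNM 1716 (1999), §2,
  pp. 62–63 (Kummer theory, `Im κ ⊆ Sel`).
* [SilvermanAEC2009] J. H. Silverman, *The Arithmetic of Elliptic Curves*, 2nd ed. (2009),
  Prop. VII.6.3, VIII.§1–2, Thm. VIII.6.7.
* [Skinner2020] C. Skinner, Ann. of Math. 191 (2020), §2.2 (the rank-one converse direction).
-/

set_option linter.dupNamespace false

noncomputable section

open scoped Classical

open WeierstrassCurve Literature.NumberTheory.EllipticCurves
open Literature.NumberTheory.GaloisRepresentations (map_oneCocycleClass oneCocycleClass_eq_zero_iff)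

universe u

namespace Summit.BirchSwinnertonDyer.BirchSwinnertonDyer.Theorems

/-! ### 1. Pure algebra: `ℤ_p`-combinations, basis coordinates -/

/-- **Integers `s, t`, not both divisible by `p`, with `s u₂ + t u₁ ∈ p^N ℤ_p`.** In the valuation
ring `ℤ_p` one of `u₁, u₂` divides the other, say `u₂ = u₁ c`; approximating `-c` by an integer
`t` modulo `p^N` (`PadicInt.appr_spec`, density of `ℤ` in `ℤ_p`) gives `u₂ + t u₁ = u₁ (c + t)`.
[folklore] -/
private theorem exists_int_pow_dvd_combination (p : ℕ) [Fact p.Prime] (u₁ u₂ : ℤ_[p]) (N : ℕ) :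
    ∃ s t : ℤ, (¬ (p : ℤ) ∣ s ∨ ¬ (p : ℤ) ∣ t) ∧
      (p : ℤ_[p]) ^ N ∣ (s : ℤ_[p]) * u₂ + (t : ℤ_[p]) * u₁ := by
  have hp : p.Prime := Fact.out
  have h1 : ¬ (p : ℤ) ∣ 1 := fun h =>
    hp.one_lt.ne' (by exact_mod_cast Int.eq_one_of_dvd_one (Int.natCast_nonneg p) h)
  obtain ⟨c, hc | hc⟩ := ValuationRing.cond u₁ u₂
  · refine ⟨1, -(c.appr N : ℤ), Or.inl h1, ?_⟩
    have hspec := PadicInt.appr_spec N c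
    rw [Ideal.mem_span_singleton] at hspec
    have heq : ((1 : ℤ) : ℤ_[p]) * u₂ + ((-(c.appr N : ℤ) : ℤ) : ℤ_[p]) * u₁ =
        u₁ * (c - (c.appr N : ℤ_[p])) := by
      rw [← hc]; push_cast; ring
    rw [heq]
    exact hspec.mul_left u₁
  · refine ⟨-(c.appr N : ℤ), 1, Or.inr h1, ?_⟩
    have hspec := PadicInt.appr_spec N c
    rw [Ideal.mem_span_singleton] at hspec
    have heq : ((-(c.appr N : ℤ) : ℤ) : ℤ_[p]) * u₂ + ((1 : ℤ) : ℤ_[p]) * u₁ =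
        u₂ * (c - (c.appr N : ℤ_[p])) := by
      rw [← hc]; push_cast; ring
    rw [heq]
    exact hspec.mul_left u₂

/-- **Coordinate functionals of a Mordell–Weil basis.** For a Mordell–Weil basis `b` and indices
`i ≠ j` there is a homomorphism `φ : E(K) → ℤ` with `φ(b_j) = 1`, `φ(b_i) = 0`: the `j`-th
coordinate of the `ℤ`-basis of `E(K)/E(K)_{tors}` formed by the classes of the `b_k`
(`Module.Basis.mk`, `Module.Basis.coord`), composed with the quotient map. Silverman, AEC, VIII.§6
(`E(K) ≅ E(K)_{tors} × ℤ^r`). [folklore] -/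
private theorem exists_addMonoidHom_int_apply_eq {K : Type*} [Field K] (W : WeierstrassCurve K)
    {ι : Type*} {b : ι → W.toAffine.Point} (hb : IsMordellWeilBasis b) {i j : ι} (hij : i ≠ j) :
    ∃ φ : W.toAffine.Point →+ ℤ, φ (b j) = 1 ∧ φ (b i) = 0 := by
  let B : Module.Basis ι ℤ (mordellWeilModTorsion W) := Module.Basis.mk hb.1 hb.2.ge
  have hB : ∀ k, B k = QuotientAddGroup.mk (b k) := fun k => Module.Basis.mk_apply hb.1 hb.2.ge k
  refine ⟨(B.coord j).toAddMonoidHom.comp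
    (QuotientAddGroup.mk' (AddCommGroup.torsion W.toAffine.Point)), ?_, ?_⟩
  · change B.coord j (QuotientAddGroup.mk (b j)) = 1
    rw [← hB, Module.Basis.coord_apply, Module.Basis.repr_self, Finsupp.single_eq_same]
  · change B.coord j (QuotientAddGroup.mk (b i)) = 0
    rw [← hB, Module.Basis.coord_apply, Module.Basis.repr_self, Finsupp.single_eq_of_ne hij.symm]

/-- **Reading a coordinate.** If `φ : G → ℤ` is additive with `φ(P₂) = 1`, `φ(P₁) = 0` and
`p^{m'} · k (s P₂ + t P₁) = p^{N+m'} P₀`, then `p^N ∣ k s` (apply `φ` and cancel `p^{m'}`).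
[folklore] -/
private theorem pow_dvd_mul_of_nsmul_eq {G : Type*} [AddCommGroup G] (φ : G →+ ℤ) {P₁ P₂ P₀ : G}
    (h₂ : φ P₂ = 1) (h₁ : φ P₁ = 0) {p : ℕ} (hp : p ≠ 0) {m' N k : ℕ} {s t : ℤ}
    (h : p ^ m' • (k • (s • P₂ + t • P₁)) = p ^ (N + m') • P₀) :
    (p : ℤ) ^ N ∣ (k : ℤ) * s := by
  have h' := congrArg φ h
  simp only [map_nsmul, map_add, map_zsmul, h₂, h₁, smul_eq_mul, nsmul_eq_mul, mul_one, mul_zero,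
    add_zero, Nat.cast_pow] at h'
  refine ⟨φ P₀, mul_left_cancel₀ (pow_ne_zero m' (Int.natCast_ne_zero.mpr hp)) ?_⟩
  linear_combination h'

/-! ### 2. Local triviality of Kummer classes of locally divisible points -/

/-- **A point divisible by `p^N` in `E(E)` has locally trivial level-`N` Kummer class.** Let `K` be a
field, `E` a `K`-field, `X ∈ E(K)` with `X = p^N R` in `E(E)`, and `p^N Q = X` in `E(K̄)`. Then the
Kummer class `κ_N(X) = [σ ↦ σQ - Q] ∈ H¹(K, E[p^∞])` restricts to `0` in `H¹(E, E(Ē)[p^∞])` along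
the chosen embedding `K̄ → Ē` (i.e. lies in `selmerLocalKerPrimaryTorsion W E p`): the restricted
cocycle `τ ↦ τ ιQ - ιQ` (`map_oneCocycleClass`, `pointsMap_smul`) is the coboundary `τ ↦ τ v - v`
of `v = ιQ - R ∈ E(Ē)[p^N]`, because `R` (coordinates in `E`) is fixed by `Γ_E` and
`p^N v = ιX - ιX = 0` (`oneCocycleClass_eq_zero_iff`). This is the inclusion
`im (E(E) → H¹(E, E[p^N]))^⊥`-type statement "locally a Kummer class of a `p^N`-divisible point is
trivial"; Silverman, AEC, VIII.§2 (Kummer pairing, `δ(P) = 0 ⇔ P ∈ mE`) read over `E`;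
Greenberg 1999, §2, pp. 62–63. [folklore] -/
theorem kummerMapLevel_mem_selmerLocalKerPrimaryTorsion_of_eq_nsmul {K : Type u} [Field K]
    (W : WeierstrassCurve K) (p : ℕ) [Fact p.Prime] (hdiv : W.zsmul_geomPoints_surjective)
    [W.IsElliptic] (E : Type u) [Field E] [Algebra K E] (N : ℕ) (X : W.toAffine.Point)
    (R : (W.baseChange E).toAffine.Point)
    (hX : Affine.Point.baseChange (W' := W) K E X = p ^ N • R) :
    kummerMapLevel W p hdiv N X ∈ selmerLocalKerPrimaryTorsion W E p := by
  have hQ : p ^ N • kummerRoot W p hdiv N X = toGeomPoints W X := nsmul_kummerRoot W p hdiv N X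
  set Q := kummerRoot W p hdiv N X with hQdef
  -- the image `R'` of `R` in `E(Ē)`
  obtain ⟨R', hR'⟩ : ∃ R' : localPoints W E, R' =
      Affine.Point.map (W' := W) (IsScalarTower.toAlgHom K E (AlgebraicClosure E)) R := ⟨_, rfl⟩
  -- `R'` is fixed by `Γ_E`
  have hcomp : ∀ τ : Field.absoluteGaloisGroup E,
      ((AlgEquiv.restrictScalars K (show AlgebraicClosure E ≃ₐ[E] AlgebraicClosure E from τ) :
            AlgebraicClosure E ≃ₐ[K] AlgebraicClosure E) :
          AlgebraicClosure E →ₐ[K] AlgebraicClosure E).comp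
        (IsScalarTower.toAlgHom K E (AlgebraicClosure E)) =
      IsScalarTower.toAlgHom K E (AlgebraicClosure E) := fun τ =>
    AlgHom.ext fun x => (show AlgebraicClosure E ≃ₐ[E] AlgebraicClosure E from τ).commutes x
  have hfixR : ∀ τ : Field.absoluteGaloisGroup E, τ • R' = R' := fun τ => by
    rw [hR', localPoints.smul_def]
    change Affine.Point.map _ (Affine.Point.map _ R) = Affine.Point.map _ R
    rw [Affine.Point.map_map, hcomp τ]
  -- `ι X = p ^ N • R'` and `ι X = pointsMap (toGeomPoints X)`
  have hjX : (Affine.Point.map (W' := W) (IsScalarTower.toAlgHom K E (AlgebraicClosure E))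
      (Affine.Point.baseChange (W' := W) K E X) : localPoints W E) =
        pointsMap W E (toGeomPoints W X) := by
    change Affine.Point.map _ (Affine.Point.baseChange (W' := W) K E X) =
      Affine.Point.map (closureEmb (K := K) E)
        (Affine.Point.baseChange (W' := W) K (AlgebraicClosure K) X)
    rw [Affine.Point.map_baseChange, Affine.Point.map_baseChange]
  have h1 : (Affine.Point.map (W' := W) (IsScalarTower.toAlgHom K E (AlgebraicClosure E))
      (Affine.Point.baseChange (W' := W) K E X) : localPoints W E) = p ^ N • R' := by
    rw [hX, hR']
    exact map_nsmul _ _ _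
  have hv0 : p ^ N • (pointsMap W E Q - R') = 0 := by
    rw [smul_sub, ← map_nsmul, hQ, ← hjX, h1, sub_self]
  -- the restricted class is the coboundary of `v = ι Q - R'`
  unfold selmerLocalKerPrimaryTorsion
  rw [resKer_eq_ker, AddMonoidHom.mem_ker]
  refine Eq.trans (map_oneCocycleClass _ (resGal (K := K) E)
    (resHomOfEquivariant (resGal (K := K) E) (primaryPointsMap W E p) (primaryPointsMap_smul W E p))
    (kummerCocycle W p N Q (smul_nsmul_of_nsmul_eq W p hQ))) ?_
  rw [oneCocycleClass_eq_zero_iff]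
  refine ⟨(⟨pointsMap W E Q - R', ⟨N, hv0⟩⟩ : AddCommGroup.primaryComponent (localPoints W E) p),
    fun τ => Subtype.ext ?_⟩
  change pointsMap W E (resGal (K := K) E τ • Q - Q) =
    τ • (pointsMap W E Q - R') - (pointsMap W E Q - R')
  rw [map_sub, pointsMap_smul, smul_sub, hfixR]
  abel

/-! ### 3. Supply of strict Selmer classes of every level -/

/-- **Strict Selmer classes of level `N` from two rational points.** Let `E/K` be an elliptic curve
over a number field, `E` a `K`-field such that `E(E)` has a subgroup `A ≅ ℤ_p` of finite index
`m`, and `λ(X) = e(mX) ∈ ℤ_p`. For `P₁, P₂ ∈ E(K)` and every `N` there are integers `s, t`, not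
both divisible by `p`, with `s λ(P₂) + t λ(P₁) = p^N w` (`exists_int_pow_dvd_combination`); then
`m (s P₂ + t P₁) = p^N e⁻¹(w)` in `E(E)`, so `κ_N(m(s P₂ + t P₁))` is locally trivial at `E`
(`kummerMapLevel_mem_selmerLocalKerPrimaryTorsion_of_eq_nsmul`) and Selmer (Kummer classes die in
`H¹(K, E)`, `ker_primaryH1ToH1_le_selmerGroupPInfty`; Greenberg 1999, §2, p. 63: "obviously
`Im κ ⊆ Sel_E(M)_p`"). [folklore] -/
theorem exists_kummerMapLevel_mem_strictSelmer {K : Type u} [Field K] [NumberField K]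
    (W : WeierstrassCurve K) [W.IsElliptic] (p : ℕ) [Fact p.Prime]
    (hdiv : W.zsmul_geomPoints_surjective) (E : Type u) [Field E] [Algebra K E]
    (A : AddSubgroup (W.baseChange E).toAffine.Point) (e : A ≃+ ℤ_[p])
    (P₁ P₂ : W.toAffine.Point) (N : ℕ) :
    ∃ s t : ℤ, (¬ (p : ℤ) ∣ s ∨ ¬ (p : ℤ) ∣ t) ∧
      kummerMapLevel W p hdiv N (A.index • (s • P₂ + t • P₁)) ∈
        W.selmerGroupPInfty p ⊓ selmerLocalKerPrimaryTorsion W E p := by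
  let bc : W.toAffine.Point →+ (W.baseChange E).toAffine.Point :=
    Affine.Point.baseChange (W' := W) K E
  let mulIdx : (W.baseChange E).toAffine.Point →+ A :=
    AddMonoidHom.mk' (fun X => ⟨A.index • X, A.nsmul_index_mem X⟩) fun X Y =>
      Subtype.ext (smul_add (A.index) X Y)
  let lam : W.toAffine.Point →+ ℤ_[p] := e.toAddMonoidHom.comp (mulIdx.comp bc)
  have hlam : ∀ X, ((e.symm (lam X) : A) : (W.baseChange E).toAffine.Point) = A.index • bc X :=
    fun X => by
      change ((e.symm (e (mulIdx (bc X))) : A) : (W.baseChange E).toAffine.Point) = _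
      rw [e.symm_apply_apply]
      rfl
  obtain ⟨s, t, hst, w, hw⟩ := exists_int_pow_dvd_combination p (lam P₁) (lam P₂) N
  refine ⟨s, t, hst, ?_, ?_⟩
  · exact ker_primaryH1ToH1_le_selmerGroupPInfty W p
      ((AddMonoidHom.mem_ker).mpr (primaryH1ToH1_kummerMapLevel W p hdiv N _))
  · have hw' : lam (s • P₂ + t • P₁) = p ^ N • w := by
      rw [map_add, map_zsmul, map_zsmul, zsmul_eq_mul, zsmul_eq_mul, hw, nsmul_eq_mul,
        Nat.cast_pow]
    refine kummerMapLevel_mem_selmerLocalKerPrimaryTorsion_of_eq_nsmul W p hdiv E N _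
      ((e.symm w : A) : (W.baseChange E).toAffine.Point) ?_
    change bc (A.index • (s • P₂ + t • P₁)) = _
    rw [map_nsmul, ← hlam, hw', map_nsmul, AddSubgroupClass.coe_nsmul]

/-! ### 4. Infinitude of the strict Selmer group in rank `≥ 2` -/

/-- **Rank `≥ 2` makes the `p`-strict Selmer group infinite — general form.** For an elliptic
curve `E` over a number field `K`, a prime `p`, and a `K`-field `E` such that `E(E)` has a
finite-index subgroup `A ≅ ℤ_p` (index `m`): if `rank_ℤ E(K) ≥ 2` then
`Sel_{p^∞}(E/K) ∩ ker (H¹(K, E[p^∞]) → H¹(E, E(Ē)[p^∞]))` is infinite. Were it finite of order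
`n`, take `P₁, P₂` in a Mordell–Weil basis (`exists_isMordellWeilBasis_holds`) and `N = n m`: the
strict Selmer class `κ_N(m(s P₂ + t P₁))` (`exists_kummerMapLevel_mem_strictSelmer`) is killed by
`n`, so `κ_N(n m (s P₂ + t P₁)) = 0` and `p^{m'} n m (s P₂ + t P₁) = p^{N+m'} P₀`
(`exists_of_kummerMapLevel_eq_zero`); the two basis coordinates in `E(K)/tors` give
`p^N ∣ n m s`, `p^N ∣ n m t`, hence `p^N ∣ n m = N < p^N`, absurd. The corank heuristic behind it:
`ker (E(K) ⊗ ℚ_p/ℤ_p → E(E) ⊗ ℚ_p/ℤ_p)` has corank `≥ rank - 1 ≥ 1`. Greenberg 1999, §2,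
pp. 62–63 (Kummer theory); Silverman AEC VIII.§6. [cite: Greenberg1999LNM, §2 pp. 62–63] -/
theorem infinite_strictSelmer_of_two_le_mordellWeilRank_of_addEquiv {K : Type u} [Field K]
    [NumberField K] (W : WeierstrassCurve K) [W.IsElliptic] (p : ℕ) [Fact p.Prime]
    (E : Type u) [Field E] [Algebra K E]
    (A : AddSubgroup (W.baseChange E).toAffine.Point) [A.FiniteIndex] (e : A ≃+ ℤ_[p])
    (hrank : 2 ≤ W.mordellWeilRank) :
    Infinite ↥(W.selmerGroupPInfty p ⊓ selmerLocalKerPrimaryTorsion W E p) := by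
  have hp : p.Prime := Fact.out
  have hdiv : W.zsmul_geomPoints_surjective := W.zsmul_geomPoints_surjective_holds
  obtain ⟨b, hb⟩ := W.exists_isMordellWeilBasis_holds
  let i₁ : Fin W.mordellWeilRank := ⟨0, by omega⟩
  let i₂ : Fin W.mordellWeilRank := ⟨1, by omega⟩
  have h12 : i₁ ≠ i₂ := fun h => absurd (congrArg Fin.val h) (by simp [i₁, i₂])
  obtain ⟨φ₂, hφ₂, hφ₂'⟩ := exists_addMonoidHom_int_apply_eq W hb h12
  obtain ⟨φ₁, hφ₁, hφ₁'⟩ := exists_addMonoidHom_int_apply_eq W hb h12.symm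
  refine not_finite_iff_infinite.mp fun hfin => ?_
  set S₀ := W.selmerGroupPInfty p ⊓ selmerLocalKerPrimaryTorsion W E p with hS₀
  haveI : Finite S₀ := hfin
  have hn : 0 < Nat.card S₀ := Nat.card_pos
  have hm : A.index ≠ 0 := AddSubgroup.FiniteIndex.index_ne_zero
  have hnm : 0 < Nat.card S₀ * A.index := Nat.pos_of_ne_zero (mul_ne_zero hn.ne' hm)
  obtain ⟨s, t, hst, hmem⟩ :=
    exists_kummerMapLevel_mem_strictSelmer W p hdiv E A e (b i₁) (b i₂) (Nat.card S₀ * A.index)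
  have h0 : kummerMapLevel W p hdiv (Nat.card S₀ * A.index)
      ((Nat.card S₀ * A.index) • (s • b i₂ + t • b i₁)) = 0 := by
    rw [mul_nsmul', map_nsmul]
    have h := card_nsmul_eq_zero' (x := (⟨_, hmem⟩ : S₀))
    exact congrArg Subtype.val h
  obtain ⟨m', P₀, hP₀⟩ := exists_of_kummerMapLevel_eq_zero W p hdiv _ _ h0
  have hd₂ : (p : ℤ) ^ (Nat.card S₀ * A.index) ∣ ((Nat.card S₀ * A.index : ℕ) : ℤ) * s :=
    pow_dvd_mul_of_nsmul_eq φ₂ hφ₂ hφ₂' hp.ne_zero hP₀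
  have hd₁ : (p : ℤ) ^ (Nat.card S₀ * A.index) ∣ ((Nat.card S₀ * A.index : ℕ) : ℤ) * t := by
    rw [add_comm (s • b i₂)] at hP₀
    exact pow_dvd_mul_of_nsmul_eq φ₁ hφ₁ hφ₁' hp.ne_zero hP₀
  have hpZ : Prime (p : ℤ) := Nat.prime_iff_prime_int.mp hp
  have hdvd : (p : ℤ) ^ (Nat.card S₀ * A.index) ∣ ((Nat.card S₀ * A.index : ℕ) : ℤ) := by
    rcases hst with hs | ht
    · exact hpZ.pow_dvd_of_dvd_mul_right _ hs hd₂
    · exact hpZ.pow_dvd_of_dvd_mul_right _ ht hd₁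
  rw [← Nat.cast_pow, Int.natCast_dvd_natCast] at hdvd
  exact absurd (Nat.le_of_dvd hnm hdvd) (not_le.mpr (Nat.lt_pow_self hp.one_lt))

/-! ### 5. The stub -/

/-- Stub **S3** of line `Sketch` for the crux `PlecticRankUB` (design lemma, ℚ-shadow of the
relaxed-at-`p` core-rank-`d` engine): for `E/ℚ` of rank `≥ 2` and any prime `p`, the `p`-strict
Selmer group `Sel_{p^∞}(E/ℚ) ∩ ker (H¹(ℚ, E[p^∞]) → H¹(ℚ_p, E(ℚ̄_p)[p^∞]))` is infinite (it
contains Kummer classes `κ_N` of every level `N`, built from two independent points made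
`p^N`-divisible in `E(ℚ_p) ≅ ℤ_p × (finite)`, Silverman AEC VII.6.3 =
`exists_finiteIndex_addEquiv_padicInt_holds`). Converse companion of the tree theorem
`finite_strictSelmer_of_mordellWeilRank_eq_one`; the general form is
`infinite_strictSelmer_of_two_le_mordellWeilRank_of_addEquiv`.
[cite: SilvermanAEC2009, Prop. VII.6.3 (with Greenberg 1999, §2, pp. 62–63)] -/
theorem stub_strictSelmerInfinite :
    ∀ (W : WeierstrassCurve ℚ) [W.IsElliptic] (p : ℕ) [Fact p.Prime], 2 ≤ W.mordellWeilRank →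
      Infinite ↥(W.selmerGroupPInfty p ⊓ selmerLocalKerPrimaryTorsion W ℚ_[p] p) := by
  intro W _ p _ hrank
  obtain ⟨A, hA, ⟨e⟩⟩ := exists_finiteIndex_addEquiv_padicInt_holds p (W.baseChange ℚ_[p])
  haveI := hA
  exact infinite_strictSelmer_of_two_le_mordellWeilRank_of_addEquiv W p ℚ_[p] A e hrank

end Summit.BirchSwinnertonDyer.BirchSwinnertonDyer.Theorems

end
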